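import Summits.AnomalousDissipation.AnomalousDissipation.Theorems.SawtoothPulseCascadeK1LocalisedCascadeFibreMinkowski

/-!
# K1loc explicit start — helper: TUBE CAUCHY–SCHWARZ ON A V-FIBRE («VFibreTube», phase-1 dischargers j_V / j_O)

Helper file of the prover lane on the crux `K1LocalisedCascade` (stmt-AnomalousDissipation-19491), route `SawtoothPulseCascade`
(arbiter A24-5 R1: phase-1 completion `j_V`, `j_O`).  On one V-fibre `k₁ = n` of a V half-step `θ ↦ θ ∘ shearMap 1 0 ψ` the window
energy `X = Σ_{m∈W} ‖𝓕(θ∘Φ)(m,n)‖²` is bounded from `K1Window.sqrt_window_sq_norm_vstep_le` (Minkowski over a finite «tube» `S` of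
sources, `ℓ²` contraction of the rest) by a WEIGHTED CAUCHY–SCHWARZ step on the tube:
  `X ≤ (1+t)·(Σ_{q∈S} ‖c_q‖²/u_q)·(Σ_{q∈S} u_q μ_n(q)) + (1+1/t)·Σ'_{q∉S} ‖c_q‖²`,
  `c_q = 𝓕θ(q,n)`, `μ_n(q) = Σ_{m∈W} ‖ĝ_n(m−q)‖²`, any `u > 0` on `S`, any `t > 0`
(`vfibre_window_sq_le`), so that after summing over fibres the first factor is a weighted H-fibre ENERGY of `θ` (first-order data)
and the last term is the energy of `θ` off the tube.  Pure bookkeeping; no definitions; nothing about the crux.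
[cite: Grafakos2014, Prop. 3.1.2 (5), Prop. 3.2.7 (3)] [problem: turb]
-/

-- `Summit.<Summit>.<Problem>`: single-conjunct summit, the duplicate namespace segment is deliberate.
set_option linter.dupNamespace false

noncomputable section

namespace Summit.AnomalousDissipation.AnomalousDissipation.Theorems.SawtoothPulseCascade.K1Window

open MeasureTheory Filter Topology UnitAddTorus Complex AddCircle
open scoped Real
open Literature.Analysis.FunctionSpaces Literature.Analysis.FunctionSpaces.Torus
open Summit.AnomalousDissipation.AnomalousDissipation.Theorems.SawtoothPulseCascade.K1Start

/-! ## §1 Two scalar inequalities -/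

/-- **Weighted Cauchy–Schwarz on a finite set**: for `u > 0` on `S`,
`(Σ_{q∈S} x_q y_q)² ≤ (Σ_{q∈S} x_q²/u_q)·(Σ_{q∈S} u_q y_q²)`. [folklore] -/
theorem sq_sum_mul_le_weighted (S : Finset ℤ) (x y u : ℤ → ℝ) (hu : ∀ q ∈ S, 0 < u q) :
    (∑ q ∈ S, x q * y q) ^ 2 ≤ (∑ q ∈ S, x q ^ 2 / u q) * (∑ q ∈ S, u q * y q ^ 2) := by
  have h := Finset.sum_mul_sq_le_sq_mul_sq S (fun q => x q / Real.sqrt (u q)) (fun q => Real.sqrt (u q) * y q)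
  have e1 : ∑ q ∈ S, x q / Real.sqrt (u q) * (Real.sqrt (u q) * y q) = ∑ q ∈ S, x q * y q := by
    refine Finset.sum_congr rfl fun q hq => ?_
    have hs : Real.sqrt (u q) ≠ 0 := (Real.sqrt_pos.2 (hu q hq)).ne'
    field_simp
  have e2 : ∑ q ∈ S, (x q / Real.sqrt (u q)) ^ 2 = ∑ q ∈ S, x q ^ 2 / u q := by
    refine Finset.sum_congr rfl fun q hq => ?_
    rw [div_pow, Real.sq_sqrt (hu q hq).le]
  have e3 : ∑ q ∈ S, (Real.sqrt (u q) * y q) ^ 2 = ∑ q ∈ S, u q * y q ^ 2 := by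
    refine Finset.sum_congr rfl fun q hq => ?_
    rw [mul_pow, Real.sq_sqrt (hu q hq).le]
  rw [e1, e2, e3] at h
  exact h

/-- **Peter–Paul**: `(a + b)² ≤ (1+t)a² + (1+1/t)b²` for `t > 0`. [folklore] -/
theorem add_sq_le_peterPaul (a b : ℝ) {t : ℝ} (ht : 0 < t) :
    (a + b) ^ 2 ≤ (1 + t) * a ^ 2 + (1 + 1 / t) * b ^ 2 := by
  have h0 : 0 ≤ (t * a - b) ^ 2 / t := div_nonneg (sq_nonneg _) ht.le
  have e : (t * a - b) ^ 2 / t = t * a ^ 2 + 1 / t * b ^ 2 - 2 * a * b := by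
    field_simp
    ring
  rw [e] at h0
  nlinarith [h0]

/-- The scalar skeleton of the tube bound: `√X ≤ A + √F`, `A² ≤ P` ⇒ `X ≤ (1+t)P + (1+1/t)F`. [folklore] -/
theorem sq_le_of_sqrt_le_add_sqrt {X A F P t : ℝ} (hF : 0 ≤ F) (hA : 0 ≤ A) (h : Real.sqrt X ≤ A + Real.sqrt F)
    (hP : A ^ 2 ≤ P) (ht : 0 < t) : X ≤ (1 + t) * P + (1 + 1 / t) * F := by
  have h1 : X ≤ (A + Real.sqrt F) ^ 2 := by
    rw [← Real.sqrt_le_sqrt_iff (by positivity), Real.sqrt_sq (by positivity)]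
    exact h
  have h2 := add_sq_le_peterPaul A (Real.sqrt F) ht
  rw [Real.sq_sqrt hF] at h2
  have h3 : (1 + t) * A ^ 2 ≤ (1 + t) * P := mul_le_mul_of_nonneg_left hP (by linarith)
  linarith

/-! ## §2 The tube Cauchy–Schwarz bound on one V-fibre -/

/-- **TUBE CAUCHY–SCHWARZ ON A V-FIBRE**: for continuous `θ` with absolutely summable coefficients, `a' = θ ∘ shearMap 1 0 ψ`,
a fibre `k₁ = n`, a window `W`, a finite tube `S` of source modes with weights `u > 0` on `S`, and `t > 0`,
`Σ_{m∈W}‖𝓕a'(m,n)‖² ≤ (1+t)(Σ_{q∈S}‖𝓕θ(q,n)‖²/u_q)(Σ_{q∈S} u_q Σ_{m∈W}‖ĝ_n(m−q)‖²) + (1+1/t)Σ'_{q∉S}‖𝓕θ(q,n)‖²`.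
[cite: Grafakos2014, Prop. 3.1.2 (5), Prop. 3.2.7 (3)] -/
theorem vfibre_window_sq_le {θ : UnitAddTorus (Fin 2) → ℂ} (hθ : Continuous θ)
    (hsum : Summable fun k => ‖mFourierCoeff θ k‖) (ψ : ShearProfile) (n : ℤ) (S W : Finset ℤ) (u : ℤ → ℝ)
    (hu : ∀ q ∈ S, 0 < u q) {t : ℝ} (ht : 0 < t) :
    ∑ m ∈ W, ‖mFourierCoeff (θ ∘ shearMap 1 0 ψ) ![m, n]‖ ^ 2 ≤
      (1 + t) * ((∑ q ∈ S, ‖mFourierCoeff θ ![q, n]‖ ^ 2 / u q) *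
          (∑ q ∈ S, u q * ∑ m ∈ W, ‖fourierCoeff (twist ψ n) (m - q)‖ ^ 2)) +
        (1 + 1 / t) * ∑' q : ℤ, (if q ∈ S then 0 else ‖mFourierCoeff θ ![q, n]‖ ^ 2) := by
  have hmink := sqrt_window_sq_norm_vstep_le hθ hsum ψ n S W
  refine sq_le_of_sqrt_le_add_sqrt (tsum_nonneg fun p => by split_ifs <;> positivity)
    (Finset.sum_nonneg fun _ _ => mul_nonneg (norm_nonneg _) (Real.sqrt_nonneg _)) hmink ?_ ht
  -- `A² ≤ (Σ ‖c‖²/u)(Σ u μ)` by weighted Cauchy–Schwarz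
  have h := sq_sum_mul_le_weighted S (fun q => ‖mFourierCoeff θ ![q, n]‖)
    (fun q => Real.sqrt (∑ m ∈ W, ‖fourierCoeff (twist ψ n) (m - q)‖ ^ 2)) u hu
  have e : ∀ q, Real.sqrt (∑ m ∈ W, ‖fourierCoeff (twist ψ n) (m - q)‖ ^ 2) ^ 2 =
      ∑ m ∈ W, ‖fourierCoeff (twist ψ n) (m - q)‖ ^ 2 := fun q =>
    Real.sq_sqrt (Finset.sum_nonneg fun _ _ => sq_nonneg _)
  simp only [e] at h
  exact h

/-- **Unweighted form** (`u ≡ 1`): `Σ_{m∈W}‖𝓕a'(m,n)‖² ≤ (1+t)(Σ_{q∈S}‖𝓕θ(q,n)‖²)(Σ_{q∈S} μ_n(q)) + (1+1/t)Σ'_{q∉S}‖𝓕θ(q,n)‖²`.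
[cite: Grafakos2014, Prop. 3.2.7 (3)] -/
theorem vfibre_window_sq_le_one {θ : UnitAddTorus (Fin 2) → ℂ} (hθ : Continuous θ)
    (hsum : Summable fun k => ‖mFourierCoeff θ k‖) (ψ : ShearProfile) (n : ℤ) (S W : Finset ℤ) {t : ℝ} (ht : 0 < t) :
    ∑ m ∈ W, ‖mFourierCoeff (θ ∘ shearMap 1 0 ψ) ![m, n]‖ ^ 2 ≤
      (1 + t) * ((∑ q ∈ S, ‖mFourierCoeff θ ![q, n]‖ ^ 2) *
          (∑ q ∈ S, ∑ m ∈ W, ‖fourierCoeff (twist ψ n) (m - q)‖ ^ 2)) +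
        (1 + 1 / t) * ∑' q : ℤ, (if q ∈ S then 0 else ‖mFourierCoeff θ ![q, n]‖ ^ 2) := by
  have h := vfibre_window_sq_le hθ hsum ψ n S W (fun _ => 1) (fun _ _ => one_pos) ht
  simpa only [div_one, one_mul] using h

/-! ## §3 Summing the tube over fibres: first-order data -/

/-- **Tube energies sum to an H-weighted energy**: for `0 ≤ c` summable on `ℤ²`, fibres `n ∈ B` and tubes `S n`, if every
source `q ∈ S n` (`n ∈ B`) has `1/u q ≤ w q` with `0 ≤ w ≤ C`, then `Σ_{n∈B} Σ_{q∈S n} c(q,n)/u q ≤ Σ'_k w(k₀) c k`. [folklore] -/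
theorem sum_tube_div_le_tsum_hweight (c : (Fin 2 → ℤ) → ℝ) (hc : Summable c) (hc0 : ∀ k, 0 ≤ c k) (B : Finset ℤ)
    (S : ℤ → Finset ℤ) (u w : ℤ → ℝ) (hw0 : ∀ q, 0 ≤ w q) {C : ℝ} (hwC : ∀ q, w q ≤ C)
    (hle : ∀ n ∈ B, ∀ q ∈ S n, 1 / u q ≤ w q) :
    ∑ n ∈ B, ∑ q ∈ S n, c ![q, n] / u q ≤ ∑' k : Fin 2 → ℤ, w (k 0) * c k := by
  classical
  -- the finite set of lattice points of the tube
  set T : Finset (Fin 2 → ℤ) := B.biUnion fun n => (S n).image fun q => ![q, n] with hT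
  have hinj : ∀ n, Set.InjOn (fun q : ℤ => (![q, n] : Fin 2 → ℤ)) ↑(S n) := fun n a _ b _ h => by
    have := congrFun h 0; simpa using this
  -- rewrite the double sum as a sum over `T`
  have h1 : ∑ n ∈ B, ∑ q ∈ S n, c ![q, n] / u q = ∑ k ∈ T, c k / u (k 0) := by
    rw [hT, Finset.sum_biUnion]
    · refine Finset.sum_congr rfl fun n hn => ?_
      rw [Finset.sum_image (hinj n)]
      refine Finset.sum_congr rfl fun q hq => ?_
      simp
    · intro n hn n' hn' hne
      simp only [Function.onFun]
      rw [Finset.disjoint_left]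
      intro k hk hk'
      rw [Finset.mem_image] at hk hk'
      obtain ⟨q, _, rfl⟩ := hk
      obtain ⟨q', _, h⟩ := hk'
      have := congrFun h 1
      simp at this
      exact hne this.symm
  rw [h1]
  -- compare with the weighted series termwise on `T`, zero elsewhere
  have hs : Summable fun k : Fin 2 → ℤ => w (k 0) * c k :=
    Summable.of_nonneg_of_le (fun k => mul_nonneg (hw0 _) (hc0 k))
      (fun k => mul_le_mul_of_nonneg_right (hwC _) (hc0 k)) (hc.mul_left C)
  have h2 : ∑ k ∈ T, c k / u (k 0) ≤ ∑ k ∈ T, w (k 0) * c k := by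
    refine Finset.sum_le_sum fun k hk => ?_
    rw [hT, Finset.mem_biUnion] at hk
    obtain ⟨n, hn, hk⟩ := hk
    rw [Finset.mem_image] at hk
    obtain ⟨q, hq, rfl⟩ := hk
    simp only [Matrix.cons_val_zero]
    rw [div_eq_mul_one_div, mul_comm]
    exact mul_le_mul_of_nonneg_right (hle n hn q hq) (hc0 _)
  exact h2.trans (hs.sum_le_tsum T (fun k _ => mul_nonneg (hw0 _) (hc0 k)))

/-- **Off-tube energies sum to the off-tube lattice energy**: for `0 ≤ c` summable and an indicator `χ` of the complement of the
tube (`χ(q,n) = 1` whenever `n ∈ B`, `q ∉ S n`; `0 ≤ χ ≤ 1`), `Σ_{n∈B} Σ'_{q∉S n} c(q,n) ≤ Σ'_k χ k · c k`. [folklore] -/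
theorem sum_offTube_le_tsum (c : (Fin 2 → ℤ) → ℝ) (hc : Summable c) (hc0 : ∀ k, 0 ≤ c k) (B : Finset ℤ)
    (S : ℤ → Finset ℤ) (χ : (Fin 2 → ℤ) → ℝ) (hχ0 : ∀ k, 0 ≤ χ k) (hχ1 : ∀ k, χ k ≤ 1)
    (hχ : ∀ n ∈ B, ∀ q, q ∉ S n → χ ![q, n] = 1) :
    ∑ n ∈ B, ∑' q : ℤ, (if q ∈ S n then 0 else c ![q, n]) ≤ ∑' k : Fin 2 → ℤ, χ k * c k := by
  classical
  -- each fibre term is the lattice series of `[k₁ = n][k₀ ∉ S n] c`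
  have hfib : ∀ n, ∑' q : ℤ, (if q ∈ S n then 0 else c ![q, n]) =
      ∑' k : Fin 2 → ℤ, (if k 1 = n ∧ k 0 ∉ S n then c k else 0) := by
    intro n
    have hinj : Function.Injective (fun q : ℤ => (![q, n] : Fin 2 → ℤ)) := fun a b h => by
      have := congrFun h 0; simpa using this
    set F : (Fin 2 → ℤ) → ℝ := fun k => if k 1 = n ∧ k 0 ∉ S n then c k else 0 with hF
    have hsupp : Function.support F ⊆ Set.range (fun q : ℤ => (![q, n] : Fin 2 → ℤ)) := by
      intro k hk
      rw [Function.mem_support] at hk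
      have h1 : k 1 = n := by
        by_contra h; exact hk (by simp [hF, h])
      exact ⟨k 0, by ext i; fin_cases i <;> simp [h1]⟩
    rw [← hinj.tsum_eq hsupp]
    refine tsum_congr fun q => ?_
    simp only [hF, Matrix.cons_val_one, Matrix.cons_val_zero, true_and]
    by_cases hq : q ∈ S n
    · rw [if_pos hq, if_neg (not_not.2 hq)]
    · rw [if_neg hq, if_pos hq]
  simp_rw [hfib]
  have hsn : ∀ n, Summable fun k : Fin 2 → ℤ => (if k 1 = n ∧ k 0 ∉ S n then c k else 0) := fun n =>
    Summable.of_nonneg_of_le (fun k => by split_ifs; exacts [hc0 k, le_rfl])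
      (fun k => by split_ifs; exacts [le_rfl, hc0 k]) hc
  have hs : Summable fun k : Fin 2 → ℤ => χ k * c k :=
    Summable.of_nonneg_of_le (fun k => mul_nonneg (hχ0 k) (hc0 k))
      (fun k => mul_le_of_le_one_left (hc0 k) (hχ1 k)) hc
  rw [← Summable.tsum_finsetSum fun n _ => hsn n]
  refine Summable.tsum_le_tsum (fun k => ?_) (summable_sum fun n _ => hsn n) hs
  by_cases hk : k 1 ∈ B
  · rw [Finset.sum_eq_single (k 1) (fun n _ hn => if_neg fun h : k 1 = n ∧ k 0 ∉ S n => hn h.1.symm)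
      fun h => absurd hk h]
    by_cases hS : k 0 ∉ S (k 1)
    · rw [if_pos ⟨rfl, hS⟩]
      have e : χ k = 1 := by
        have h := hχ (k 1) hk (k 0) hS
        have ek : (![k 0, k 1] : Fin 2 → ℤ) = k := by ext i; fin_cases i <;> simp
        rwa [ek] at h
      rw [e, one_mul]
    · rw [if_neg fun h => hS h.2]
      exact mul_nonneg (hχ0 k) (hc0 k)
  · rw [Finset.sum_eq_zero fun n hn => if_neg fun h : k 1 = n ∧ k 0 ∉ S n => hk (h.1 ▸ hn)]
    exact mul_nonneg (hχ0 k) (hc0 k)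

end Summit.AnomalousDissipation.AnomalousDissipation.Theorems.SawtoothPulseCascade.K1Window
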